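import Literature.AnabelianGeometry.SemiGraphs.WitnessIwahoriGroup
import Literature.AnabelianGeometry.SemiGraphs.TemperedReconstruction
import Literature.AnabelianGeometry.SemiGraphs.ZariskiMainTheorem
import Literature.AnabelianGeometry.SemiGraphs.SubdivisionLemmas
import HarnessLib

/-!
# A concrete semi-graph of anabelioids WITH AN EDGE: one vertex, one estranged loop (witness, part 1)

Witness file of the abc-iut cell (layer L3, row WIT-1b of abc-iut-L3-lead σ3-2: non-vacuity of the
hypothesis bundles `Prop36Hypotheses` / `Thm37Hypotheses` / `Cor39Hypotheses` of [SemiAnbd] §3 ON AN OBJECT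
WITH AN EDGE; companion of abc-iut-w5-d212's edgeless WIT-1a). Source of the hypotheses: S. Mochizuki,
*Semi-graphs of anabelioids*, Publ. RIMS **42** (2006), Def. 2.1 p. 22 (injective type), Def. 2.4 (ii) p. 25
(verticially slim), Def. 2.4 (iv) p. 26 (aloof / estranged), §1 p. 11 (graph, connected, countable).

THE OBJECT `loopGraph p` (local presentation `ProfiniteSemiGraph`, universe `0`): underlying semi-graph the
bouquet `H_1` of [SemiAnbd] §1 p. 16 (one vertex `v`, one edge `e`, both branches abutting to `v`); vertex
group `Π_v := P = ℤ_p ⋊ (1 + pℤ_p)` (`Iw p`), edge group `Π_e := U = 1 + pℤ_p ≅ ℤ_p` (`IwU p`); the branch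
`(0, false)` maps `U` onto the TORUS `T_0 = {(0, s)}`, the branch `(0, true)` onto the TWISTED COMPLEMENT
`T_1 = {(s, s)}` (`Iw.bHom 0`, `Iw.bHom 1` of `WitnessIwahoriGroup`).

KERNEL-CHECKED CLAUSES (this file): `isGraph`, `hasVertex`, `isConnected`, `isCountable`,
`isOfInjectiveType`, `isVerticiallySlim` (`P` slim), `isTotallyAloof`, `isTotallyEstranged` — the edge is
ESTRANGED: `T_0 ∩ x T_1 x⁻¹ = 1` for every `x ∈ P` and `T_c ∩ x T_c x⁻¹ = 1` for `x ∉ T_c` (malnormality),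
all of infinite index. Why not `Aff(ℤ_p) = ℤ_p ⋊ ℤ_pˣ`: aloofness forces `Π_e` infinite, every infinite
procyclic subgroup of `Aff(ℤ_p)` either meets the normal translation subgroup, or is conjugate into the torus
class (one class: `H¹(ℤ_pˣ, ℤ_p) = 0`), or lies in the pro-`p` torus class normalised by `μ_{p−1}` — so no
pair of branches can be estranged there; restricting the unit coordinate to `1 + pℤ_p` gives
`H¹ = ℤ_p/p ≠ 0` and malnormal complements.

Deliberately NOT here (part 2, separate files): the approximator clauses (`isQuasiCoherent`,
`isTotallyElevated`), Galois-countability, and the assembled bundles. Nothing here concerns the disputed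
corpus; no side is taken on [IUTchIII] Cor. 3.12. [cite: MochizukiSemiAnbd2006, Def 2.4 p.25-26]
-/

noncomputable section

namespace Literature.AnabelianGeometry.SemiGraphs

open Literature.AlgebraicGeometry.Frobenioids (IsSlimGroup)

namespace IwahoriWitness

variable (p : ℕ) [Fact p.Prime]

/-! ## 1. The object -/

/-- The coefficient of a branch of `H_1`: `false ↦ 0` (torus), `true ↦ 1` (twisted complement).
[cite: MochizukiSemiAnbd2006, Def 2.1 p.22] -/
def coeff (b : (SemiGraph.bouquet.{0} 1).Branch) : ℤ_[p] := if b.down.2 then 1 else 0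

/-- **The witness `𝒢₁`**: the bouquet `H_1` with vertex group `P = ℤ_p ⋊ (1 + pℤ_p)`, edge group
`U = 1 + pℤ_p`, and branch maps the torus / the twisted complement. [cite: MochizukiSemiAnbd2006, Def 2.1 p.22] -/
def loopGraph : ProfiniteSemiGraph.{0} where
  graph := SemiGraph.bouquet.{0} 1
  Gv _ := Iw p
  Ge _ := IwU p
  brHom b _ _ := Iw.bHom (coeff p b)

/-- The branch maps of `𝒢₁` are the `b_c`. [cite: MochizukiSemiAnbd2006, Def 2.1 p.22] -/
@[simp] theorem loopGraph_brHom (b : (SemiGraph.bouquet.{0} 1).Branch) (v : (SemiGraph.bouquet.{0} 1).Vertex)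
    (h : (SemiGraph.bouquet.{0} 1).abuts b = some v) :
    (loopGraph p).brHom b v h = Iw.bHom (coeff p b) := rfl

/-- The branch subgroups of `𝒢₁` are the `T_c`. [cite: MochizukiSemiAnbd2006, §2 p.23] -/
theorem loopGraph_branchSubgroup (b : (SemiGraph.bouquet.{0} 1).Branch)
    (v : (SemiGraph.bouquet.{0} 1).Vertex) (h : (SemiGraph.bouquet.{0} 1).abuts b = some v) :
    (loopGraph p).branchSubgroup b v h = (Iw.bHom (coeff p b)).toMonoidHom.range := rfl

/-- Two distinct branches of `H_1` have distinct direction bits. [cite: MochizukiSemiAnbd2006, §1 p.16] -/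
theorem bouquet_one_branch_ne {b b' : (SemiGraph.bouquet.{0} 1).Branch} (h : b' ≠ b) :
    b'.down.2 ≠ b.down.2 := by
  intro h2
  apply h
  have h1 : b'.down.1 = b.down.1 := Subsingleton.elim _ _
  exact congrArg ULift.up (Prod.ext h1 h2)

/-- Distinct branches of `𝒢₁` carry the coefficient pair `{0, 1}`. [cite: MochizukiSemiAnbd2006, §1 p.16] -/
theorem coeff_pair_of_ne {b b' : (SemiGraph.bouquet.{0} 1).Branch} (h : b' ≠ b) :
    (coeff p b = 0 ∧ coeff p b' = 1) ∨ (coeff p b = 1 ∧ coeff p b' = 0) := by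
  have hne := bouquet_one_branch_ne h
  unfold coeff
  rcases hb : b.down.2 with _ | _ <;> rcases hb' : b'.down.2 with _ | _ <;> simp_all

/-! ## 2. The combinatorial clauses -/

/-- `𝒢₁` is a graph (every branch abuts). [cite: MochizukiSemiAnbd2006, §1 p.11] -/
theorem loopGraph_isGraph : (loopGraph p).IsGraph := SemiGraph.bouquet_isGraph 1

/-- `𝒢₁` has a vertex. [cite: MochizukiSemiAnbd2006, Thm 3.7 p.40] -/
theorem loopGraph_hasVertex : (loopGraph p).HasVertex := ⟨PUnit.unit⟩

/-- `𝒢₁` is countable (finite). [cite: MochizukiSemiAnbd2006, §1 p.11] -/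
theorem loopGraph_isCountable : (loopGraph p).IsCountable :=
  ⟨inferInstanceAs (Countable PUnit), inferInstanceAs (Countable (ULift (Fin 1)))⟩

/-- `H_1` is connected: every node of its barycentric subdivision is joined to the vertex.
[cite: MochizukiSemiAnbd2006, §1 p.11] -/
theorem bouquet_one_isConnected : (SemiGraph.bouquet.{0} 1).IsConnected := by
  classical
  set G := SemiGraph.bouquet.{0} 1
  have hbv : ∀ b : G.Branch, G.subdivision.Reachable (Sum.inr (Sum.inr b)) (Sum.inl PUnit.unit) :=
    fun b => (SemiGraph.subdivision_adj_of_nodeRel G (SemiGraph.NodeRel.branch_vertex b PUnit.unit rfl)).reachable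
  have hall : ∀ a : G.Node, G.subdivision.Reachable a (Sum.inl PUnit.unit) := by
    intro a
    rcases a with ⟨⟨⟩⟩ | e | b
    · exact SimpleGraph.Reachable.refl _
    · have h1 := (SemiGraph.subdivision_adj_of_nodeRel G (SemiGraph.NodeRel.edge_branch
        (⟨(e.down, false)⟩ : G.Branch))).reachable
      exact h1.trans (hbv _)
    · exact hbv b
  haveI : Nonempty G.Node := ⟨Sum.inl PUnit.unit⟩
  exact ⟨⟨fun a b => (hall a).trans (hall b).symm⟩⟩

/-- `𝒢₁` is connected. [cite: MochizukiSemiAnbd2006, §1 p.11] -/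
theorem loopGraph_isConnected : (loopGraph p).IsConnected := bouquet_one_isConnected

/-! ## 3. Injective type, verticial slimness -/

/-- `𝒢₁` is of injective type: both branch maps are injective. [cite: MochizukiSemiAnbd2006, Def 2.1 p.22] -/
theorem loopGraph_isOfInjectiveType : (loopGraph p).IsOfInjectiveType :=
  fun b _ _ => Iw.bHom_injective (coeff p b)

/-- `P = ℤ_p ⋊ (1 + pℤ_p)` is slim. [cite: MochizukiSemiAnbd2006, Def 2.4(ii) p.25] -/
theorem isSlimGroup_Iw : IsSlimGroup (Iw p) := ⟨Iw.centralizer_eq_bot_of_isOpen⟩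

/-- `𝒢₁` is verticially slim. [cite: MochizukiSemiAnbd2006, Def 2.4(ii) p.25] -/
theorem loopGraph_isVerticiallySlim : (loopGraph p).IsVerticiallySlim := fun _ => isSlimGroup_Iw p

/-! ## 4. The loop is estranged (hence aloof) -/

/-- The core intersection computation: for branches `b, b'` of the loop and `g ∈ P` with `b' ≠ b` or
`g ∉ Π_b`, `Π_b ∩ g Π_{b'} g⁻¹ = 1`. [cite: MochizukiSemiAnbd2006, Def 2.4(iv) p.26] -/
theorem loopGraph_branch_inf_conj_eq_bot (b b' : (SemiGraph.bouquet.{0} 1).Branch) (g : Iw p)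
    (hg : b' ≠ b ∨ g ∉ (Iw.bHom (coeff p b)).toMonoidHom.range) :
    (Iw.bHom (coeff p b)).toMonoidHom.range ⊓
        ((Iw.bHom (coeff p b')).toMonoidHom.range.map (MulAut.conj g).toMonoidHom) = ⊥ := by
  by_cases hbb : b' = b
  · subst hbb
    have hg' : g ∉ (Iw.bHom (coeff p b')).toMonoidHom.range := hg.resolve_left (fun h => h rfl)
    exact Iw.range_bHom_inf_conj_eq_bot_of_not_mem _ hg'
  · exact Iw.range_bHom_inf_conj_eq_bot_of_ne (coeff_pair_of_ne p hbb) g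

/-- Every edge of `𝒢₁` is aloof: the intersections above have infinite index (relative index `0`) in
`Π_b ≅ ℤ_p`. [cite: MochizukiSemiAnbd2006, Def 2.4(iv) p.26] -/
theorem loopGraph_isTotallyAloof : (loopGraph p).IsTotallyAloof := by
  intro e b _ v h b' h' g hg
  rw [loopGraph_branchSubgroup] at hg ⊢
  rw [loopGraph_branchSubgroup]
  exact Iw.relIndex_eq_zero_of_inf_eq_bot _ (loopGraph_branch_inf_conj_eq_bot p b b' g hg)

/-- **Every edge of `𝒢₁` is estranged** (Def. 2.4 (iv)): aloof, and the intersections are trivial.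
[cite: MochizukiSemiAnbd2006, Def 2.4(iv) p.26] -/
theorem loopGraph_isTotallyEstranged : (loopGraph p).IsTotallyEstranged := by
  intro e
  refine ⟨loopGraph_isTotallyAloof p e, ?_⟩
  intro b _ v h b' h' g hg
  rw [loopGraph_branchSubgroup] at hg ⊢
  rw [loopGraph_branchSubgroup]
  exact loopGraph_branch_inf_conj_eq_bot p b b' g hg

/-! ## 5. Summary of part 1 -/

/-- **Part 1 of the WIT-1b certificate**: a semi-graph of anabelioids WITH AN EDGE that is a connected
countable graph with a vertex, of injective type, verticially slim and totally estranged — the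
non-approximator clauses of `Cor39Hypotheses` — exists (`𝒢₁ = loopGraph p` for any prime `p`).
[cite: MochizukiSemiAnbd2006, Cor 3.9 p.42] -/
theorem exists_estranged_slim_loop (p : ℕ) [Fact p.Prime] :
    ∃ 𝒢 : ProfiniteSemiGraph.{0}, Nonempty 𝒢.graph.Edge ∧ 𝒢.IsGraph ∧ 𝒢.HasVertex ∧ 𝒢.IsConnected ∧
      𝒢.IsCountable ∧ 𝒢.IsOfInjectiveType ∧ 𝒢.IsVerticiallySlim ∧ 𝒢.IsTotallyAloof ∧ 𝒢.IsTotallyEstranged :=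
  ⟨loopGraph p, ⟨⟨0⟩⟩, loopGraph_isGraph p, loopGraph_hasVertex p, loopGraph_isConnected p,
    loopGraph_isCountable p, loopGraph_isOfInjectiveType p, loopGraph_isVerticiallySlim p,
    loopGraph_isTotallyAloof p, loopGraph_isTotallyEstranged p⟩

end IwahoriWitness

end Literature.AnabelianGeometry.SemiGraphs

end
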